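import Summits.QuantumFields.YangMills.Theorems.BalabanUVNodesN21TiltedFibreProfile
import Summits.QuantumFields.YangMills.Theorems.BalabanUVNodesN21CollarLetterOdds
import Literature.MathematicalPhysics.QuantumFieldTheory.Balaban1983to89.T4ShellMeasureFibre

/-!
# N21 (NE7c) · THE TILTED LETTER'S (M1) CONSTANT IS LINEAR IN THE TILT WORK — the inward hazard charged against the
# whole letter, the `min` junction with the ratio transfer, and the fibred (exterior-tilt) frame

R141 (C) seat pub-ymgap-dag-n21-e (g17), node N21 = NE7c (single-run shell-weight bound, NOT PRINTED in [Bałaban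
1983–89], NOT proved), strategy s3 ALTERNATIVE CURRENCY, lane K3⁷ `SpineGivenEndpointR13SepCoPH`
(stmt-QuantumFields-20544, `--kind proof --supports … --as helper`).  Part 38p of this seat's series; successor of 38o
`…N21TiltedFibreProfile` (p580948) and 38k `…N21CollarLetterOdds` (p574947); item (w-e) of the g16 HANDOFF's open list
(plan `W-SEAT-START-LIST.md` v4 §n21 item 4), unowned after the D-0149 w-seat claims (n21-w1 l.24236).

WHY (lens `ym-lens-BalabanUVNodes-nearmiss` g31 CORRECTION OF RECORD, bus l.23923 (1) ∕ memo v31.0 N211 ∕ Card 90).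
38o §2 ★ `slotAntiConcentration_tiltedLetter(_abs)` carries the density-RATIO constant `½·e^{2·osc}`,
`osc = ½aθ² + 2θ|h|` — TRUE, but sharp only for bounded-oscillation factors; for the TILT the (M1) constant is LINEAR
in the tilt work (`D ≍ x_b² + θ_bΛ_b`).  The served-vocabulary linear device the lens points to — n21-d part 8
`…N21HazardFromLogLipschitz.withDensity_exp_neg_Ico_le_of_logLipschitz` (hazard pointing RIGHT, relative to the
exceedance event) — is VOID on a letter CUT at its threshold (n21-d part 14 `nonCollapse_right_forces_zero`: there is
no mass to the right of `θ`).  The letter's linear constant comes instead from the INWARD device (hazard pointing LEFT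
on the top shell `[θ(1−ρ), θ)`, resp. RIGHT on the bottom shell `(−θ, −θ(1−ρ)]`) charged against the WHOLE letter —
38k §1 `setLIntegral_le_of_nonCollapse_window` BY NAME with window offset `r = −δ` (resp. `0`) and `δ = θ∕max(θΛ,1)`,
`Λ = aθ + |h|` the two-sided slope bound of `W(t) = ½at² + ht` on `[−θ, θ]` — so `e^{Λδ} ≤ e` and `θ∕δ = max(θΛ, 1)`:
* §1 (any measurable density `g` on `[−θ, θ]`, Lebesgue-restricted; `ρ ≤ 1`, `0 < δ ≤ θ`):
  ★ `slotAntiConcentration_letter_of_nonCollapse_left` (`D = Mθ∕δ`, statistic `t`) and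
  `slotAntiConcentration_letter_abs_of_nonCollapse` (`D = 2Mθ∕δ`, statistic `|t|`);
* §2 `nonCollapse_left_of_slope` (leftward twin of part 8 `nonCollapse_of_logLipschitz`, used BY NAME on the bottom
  shell), `tiltedPotential_sub_le` (`W` is `(aθ + |h|)`-Lipschitz on the letter), the two shell-window slopes;
* §3 ★ `slotAntiConcentration_tiltedLetter_linear` (38o's law, statistic `t`: `D = e·max(θ(aθ + |h|), 1)`),
  ★ `…_linear_abs` (statistic `|t|`: twice that); §4 `slotAntiConcentration_min` and the junctions with 38o's ★
  (`slotAntiConcentration_tiltedLetter_min` ∕ `…_abs_min`: the pen note's «≤ min(½e^{2·osc}, linear)» as ONE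
  kernel sentence each);
* the FIBRED frame (exterior law `ζ`, tilt `h : X → ℝ` with `|h z| ≤ H`; the profile pairing `H = Λ_b` of 38o §1)
  is the sibling file `…N21TiltedFibreProfileLinearFibred` (400-line rule).

HONEST FRAMING.  [textbook] real analysis (windowed hazard ∕ Tonelli) + by-name composition of landed kernel theorems
(38k §1, 38j §1, 38o §1∕§2, n21-d part 8 §3, `T4ShellMeasureFibre.slotAntiConcentration_mono`); 0 def, 0 sorry.  The
located letters `a = A_bb`, `h = Σ_y A_by z_y`, `H = Λ_b`, `θ_b`, `ρ` are HYPOTHESES (lens packaging N212 — «Θ^{eff}»,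
«kernel range», «lettered block» NOT-IN-PRINT as one function; lit-balaban desk ROW Q″ = [LF-I] = CMP 122 pp.184–186
(1.37)–(1.48), located MECHANISM only); the conditional slope bound for the ACTUAL (2.18) fibre law is NOT claimed;
nothing of Bałaban's asserted; NE7c NOT PRINTED ∕ NOT proved; N21 NOT discharged; counts unmoved (typed 28∕28 ·
discharged 5∕27); count-neutral; one finite 𝕋⁴ at fixed ε — nothing about ℝ⁴ ∕ OS ∕ mass gap ∕ Clay.
-/

set_option autoImplicit false

open MeasureTheory Set Function
open scoped ENNReal

namespace Summit.QuantumFields.YangMills.Theorems.N21TiltedFibreProfileLinear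

open Literature.MathematicalPhysics.QuantumFieldTheory.Balaban1983to89.T4ShellMeasure
  (SlotAntiConcentration shell_eq_preimage)
open Literature.MathematicalPhysics.QuantumFieldTheory.Balaban1983to89.T4ShellMeasureFibre
  (slotAntiConcentration_mono)
open Summit.QuantumFields.YangMills.Theorems.N21HazardFromLogLipschitz (nonCollapse_of_logLipschitz)
open Summit.QuantumFields.YangMills.Theorems.N21CollarLetterOdds (setLIntegral_le_of_nonCollapse_window)
open Summit.QuantumFields.YangMills.Theorems.N21TiltedFibreProfile
  (slotAntiConcentration_tiltedLetter slotAntiConcentration_tiltedLetter_abs)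

/-! ## §1  The inward hazard on a letter, charged against the whole letter -/

section LetterDevice

/-- the top shell of the one-sided statistic meets the letter in `[θ(1−ρ), θ)` (`θ > 0`, `ρ ≤ 1`). [bookkeeping] -/
theorem letterShell_inter_Icc {θ ρ : ℝ} (hθ : 0 < θ) (hρ1 : ρ ≤ 1) :
    {x : ℝ | θ * (1 - ρ) ≤ x ∧ x < θ} ∩ Icc (-θ) θ = Ico (θ * (1 - ρ)) θ := by
  have hθρ : 0 ≤ θ * (1 - ρ) := mul_nonneg hθ.le (by linarith)
  ext x
  simp only [mem_inter_iff, mem_setOf_eq, mem_Icc, mem_Ico]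
  constructor
  · rintro ⟨⟨h1, h2⟩, -⟩
    exact ⟨h1, h2⟩
  · rintro ⟨h1, h2⟩
    exact ⟨⟨h1, h2⟩, by linarith, h2.le⟩

/-- the shell of the two-sided statistic `|t|` lies in the top shell and the mirrored bottom shell. [bookkeeping] -/
theorem letterShellAbs_subset (θ ρ : ℝ) :
    {x : ℝ | θ * (1 - ρ) ≤ |x| ∧ |x| < θ} ⊆ Ico (θ * (1 - ρ)) θ ∪ Ioc (-θ) (-(θ * (1 - ρ))) := by
  rintro x ⟨h1, h2⟩
  rcases le_or_gt 0 x with hx | hx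
  · left
    rw [abs_of_nonneg hx] at h1 h2
    exact ⟨h1, h2⟩
  · right
    rw [abs_of_neg hx] at h1 h2
    exact ⟨by linarith, by linarith⟩

/-- constants: `M · δ⁻¹ · (θρ) = (Mθ∕δ)·ρ` in `ℝ≥0∞`. [bookkeeping] -/
theorem letterConst_eq {M δ θ ρ : ℝ} (hM : 0 ≤ M) (hδ : 0 < δ) :
    ENNReal.ofReal M * (ENNReal.ofReal δ)⁻¹ * ENNReal.ofReal (θ * ρ) = ENNReal.ofReal (M * θ / δ * ρ) := by
  rw [← ENNReal.ofReal_inv_of_pos hδ, ← ENNReal.ofReal_mul hM,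
    ← ENNReal.ofReal_mul (mul_nonneg hM (inv_nonneg.2 hδ.le))]
  congr 1
  rw [div_eq_mul_inv]
  ring

/-- ★ **THE INWARD HAZARD ON A LETTER ⇒ (M1), charged against the whole letter.**  A density `g` on the letter
`[−θ, θ]` (Lebesgue-restricted, any `g` measurable) that does not DROP by more than the factor `M` within distance
`δ ≤ θ` to the LEFT of the top shell `[θ(1−ρ), θ)` (`0 < ρ ≤ 1`) — every comparison window stays inside the letter —
gives `SlotAntiConcentration ((vol|[−θ,θ]).withDensity g) (t ↦ t) θ ρ (Mθ∕δ)`: 38k §1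
`setLIntegral_le_of_nonCollapse_window` with offset `r = −δ`, reference set the letter itself.  (The rightward device
of n21-d part 8 is void here: the letter carries no mass above `θ`, part 14 `nonCollapse_right_forces_zero`.)
[textbook] -/
theorem slotAntiConcentration_letter_of_nonCollapse_left {g : ℝ → ℝ≥0∞} (hg : Measurable g)
    {θ ρ δ M : ℝ} (hθ : 0 < θ) (hρ1 : ρ ≤ 1) (hδ : 0 < δ) (hδθ : δ ≤ θ) (hM : 0 ≤ M)
    (h : ∀ x ∈ Ico (θ * (1 - ρ)) θ, ∀ y ∈ Icc (x - δ) x, g x ≤ ENNReal.ofReal M * g y) :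
    SlotAntiConcentration (((volume : Measure ℝ).restrict (Icc (-θ) θ)).withDensity g) (fun t => t) θ ρ
      (M * θ / δ) := by
  unfold SlotAntiConcentration
  have hT : MeasurableSet {x : ℝ | θ * (1 - ρ) ≤ x ∧ x < θ} := by
    rw [shell_eq_preimage]; exact measurable_id measurableSet_Ico
  rw [withDensity_apply _ hT, withDensity_apply _ MeasurableSet.univ, Measure.restrict_restrict hT,
    Measure.restrict_univ, letterShell_inter_Icc hθ hρ1]
  have hθρ : 0 ≤ θ * (1 - ρ) := mul_nonneg hθ.le (by linarith)
  have hwin := setLIntegral_le_of_nonCollapse_window hg (S := Ico (θ * (1 - ρ)) θ) (T := Icc (-θ) θ)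
    measurableSet_Ico (r := -δ) hδ (ENNReal.ofReal M) ?_ ?_
  · rw [Real.volume_Ico, show θ - θ * (1 - ρ) = θ * ρ by ring, letterConst_eq hM hδ] at hwin
    exact hwin
  · intro x hx y hy
    exact h x hx y ⟨by linarith [hy.1], by linarith [hy.2]⟩
  · intro x hx y hy
    exact ⟨by linarith [hy.1, hx.1], by linarith [hy.2, hx.2]⟩

/-- **THE TWO-SIDED STATISTIC.**  The same density, not dropping by more than `M` within `δ ≤ θ` to the LEFT of the
top shell `[θ(1−ρ), θ)` and to the RIGHT of the bottom shell `(−θ, −θ(1−ρ)]` (both hazards pointing INWARD), gives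
`SlotAntiConcentration ((vol|[−θ,θ]).withDensity g) (t ↦ |t|) θ ρ (2Mθ∕δ)` — the shape the collar road's kept
letters `|w_b| < θ_b` consume (38k ∕ 38l ∕ 38m). [textbook] -/
theorem slotAntiConcentration_letter_abs_of_nonCollapse {g : ℝ → ℝ≥0∞} (hg : Measurable g)
    {θ ρ δ M : ℝ} (hθ : 0 < θ) (hρ1 : ρ ≤ 1) (hδ : 0 < δ) (hδθ : δ ≤ θ) (hM : 0 ≤ M)
    (hup : ∀ x ∈ Ico (θ * (1 - ρ)) θ, ∀ y ∈ Icc (x - δ) x, g x ≤ ENNReal.ofReal M * g y)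
    (hlow : ∀ x ∈ Ioc (-θ) (-(θ * (1 - ρ))), ∀ y ∈ Icc x (x + δ), g x ≤ ENNReal.ofReal M * g y) :
    SlotAntiConcentration (((volume : Measure ℝ).restrict (Icc (-θ) θ)).withDensity g) (fun t => |t|) θ ρ
      (2 * (M * θ / δ)) := by
  unfold SlotAntiConcentration
  have hT : MeasurableSet {x : ℝ | θ * (1 - ρ) ≤ |x| ∧ |x| < θ} := by
    rw [shell_eq_preimage]; exact continuous_abs.measurable measurableSet_Ico
  rw [withDensity_apply _ hT, withDensity_apply _ MeasurableSet.univ, Measure.restrict_restrict hT,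
    Measure.restrict_univ]
  have hθρ : 0 ≤ θ * (1 - ρ) := mul_nonneg hθ.le (by linarith)
  set I := ∫⁻ y in Icc (-θ) θ, g y
  have h1 : ∫⁻ x in Ico (θ * (1 - ρ)) θ, g x ≤ ENNReal.ofReal (M * θ / δ * ρ) * I := by
    have hwin := setLIntegral_le_of_nonCollapse_window hg (S := Ico (θ * (1 - ρ)) θ) (T := Icc (-θ) θ)
      measurableSet_Ico (r := -δ) hδ (ENNReal.ofReal M) ?_ ?_
    · rw [Real.volume_Ico, show θ - θ * (1 - ρ) = θ * ρ by ring, letterConst_eq hM hδ] at hwin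
      exact hwin
    · intro x hx y hy
      exact hup x hx y ⟨by linarith [hy.1], by linarith [hy.2]⟩
    · intro x hx y hy
      exact ⟨by linarith [hy.1, hx.1], by linarith [hy.2, hx.2]⟩
  have h2 : ∫⁻ x in Ioc (-θ) (-(θ * (1 - ρ))), g x ≤ ENNReal.ofReal (M * θ / δ * ρ) * I := by
    have hwin := setLIntegral_le_of_nonCollapse_window hg (S := Ioc (-θ) (-(θ * (1 - ρ)))) (T := Icc (-θ) θ)
      measurableSet_Ioc (r := 0) hδ (ENNReal.ofReal M) ?_ ?_
    · rw [Real.volume_Ioc, show -(θ * (1 - ρ)) - -θ = θ * ρ by ring, letterConst_eq hM hδ] at hwin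
      exact hwin
    · intro x hx y hy
      exact hlow x hx y ⟨by linarith [hy.1], by linarith [hy.2]⟩
    · intro x hx y hy
      exact ⟨by linarith [hy.1, hx.1], by linarith [hy.2, hx.2]⟩
  calc ∫⁻ x in {x : ℝ | θ * (1 - ρ) ≤ |x| ∧ |x| < θ} ∩ Icc (-θ) θ, g x
      ≤ ∫⁻ x in Ico (θ * (1 - ρ)) θ ∪ Ioc (-θ) (-(θ * (1 - ρ))), g x :=
        lintegral_mono_set (inter_subset_left.trans (letterShellAbs_subset θ ρ))
    _ ≤ (∫⁻ x in Ico (θ * (1 - ρ)) θ, g x) + ∫⁻ x in Ioc (-θ) (-(θ * (1 - ρ))), g x :=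
        lintegral_union_le _ _ _
    _ ≤ ENNReal.ofReal (M * θ / δ * ρ) * I + ENNReal.ofReal (M * θ / δ * ρ) * I := add_le_add h1 h2
    _ = ENNReal.ofReal (2 * (M * θ / δ) * ρ) * I := by
        rw [← two_mul, ← mul_assoc, show (2 : ℝ≥0∞) = ENNReal.ofReal 2 by norm_num,
          ← ENNReal.ofReal_mul (by norm_num : (0:ℝ) ≤ 2)]
        congr 2
        ring

end LetterDevice

/-! ## §2  One-sided slope bounds of the action ⇒ non-collapse of `e^{−W}`; the tilted quadratic potential -/

section Slope

/-- a LEFTWARD slope bound `W(y) − W(x) ≤ Λ(x − y)` on `x − δ ≤ y ≤ x`, `x ∈ S` (`Λ ≥ 0`) is non-collapse of `e^{−W}`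
to the left on `S` with factor `e^{Λδ}` — the mirror of n21-d part 8 `nonCollapse_of_logLipschitz`. [textbook] -/
theorem nonCollapse_left_of_slope {W : ℝ → ℝ} {S : Set ℝ} {δ Λ : ℝ} (hΛ : 0 ≤ Λ)
    (hW : ∀ x ∈ S, ∀ y ∈ Icc (x - δ) x, W y - W x ≤ Λ * (x - y)) :
    ∀ x ∈ S, ∀ y ∈ Icc (x - δ) x,
      ENNReal.ofReal (Real.exp (-W x)) ≤ ENNReal.ofReal (Real.exp (Λ * δ)) * ENNReal.ofReal (Real.exp (-W y)) := by
  intro x hx y hy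
  rw [← ENNReal.ofReal_mul (Real.exp_pos _).le, ← Real.exp_add]
  refine ENNReal.ofReal_le_ofReal (Real.exp_le_exp.2 ?_)
  have h1 := hW x hx y hy
  have h2 : Λ * (x - y) ≤ Λ * δ := mul_le_mul_of_nonneg_left (by linarith [hy.1]) hΛ
  linarith

/-- **THE TILTED QUADRATIC POTENTIAL IS `(aθ + |h|)`-LIPSCHITZ ON THE LETTER.**  For `W(t) = ½at² + ht` (`a ≥ 0`) and
`x, y ∈ [−θ, θ]`: `W(y) − W(x) ≤ (aθ + |h|)·|y − x|` (`W′(t) = at + h`). [textbook] -/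
theorem tiltedPotential_sub_le {a h θ x y : ℝ} (ha : 0 ≤ a) (hx : x ∈ Icc (-θ) θ) (hy : y ∈ Icc (-θ) θ) :
    (a / 2 * y ^ 2 + h * y) - (a / 2 * x ^ 2 + h * x) ≤ (a * θ + |h|) * |y - x| := by
  have hfac : (a / 2 * y ^ 2 + h * y) - (a / 2 * x ^ 2 + h * x) = (y - x) * (a / 2 * (x + y) + h) := by ring
  have hmid : |a / 2 * (x + y) + h| ≤ a * θ + |h| := by
    have h3 : -(a * θ) ≤ a / 2 * (x + y) := by
      nlinarith [mul_nonneg ha (by linarith [hx.1] : (0:ℝ) ≤ x + θ),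
        mul_nonneg ha (by linarith [hy.1] : (0:ℝ) ≤ y + θ)]
    have h4 : a / 2 * (x + y) ≤ a * θ := by
      nlinarith [mul_nonneg ha (by linarith [hx.2] : (0:ℝ) ≤ θ - x),
        mul_nonneg ha (by linarith [hy.2] : (0:ℝ) ≤ θ - y)]
    exact abs_le.2 ⟨by linarith [neg_abs_le h], by linarith [le_abs_self h]⟩
  rw [hfac]
  calc (y - x) * (a / 2 * (x + y) + h) ≤ |(y - x) * (a / 2 * (x + y) + h)| := le_abs_self _
    _ = |y - x| * |a / 2 * (x + y) + h| := abs_mul _ _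
    _ ≤ |y - x| * (a * θ + |h|) := mul_le_mul_of_nonneg_left hmid (abs_nonneg _)
    _ = (a * θ + |h|) * |y - x| := mul_comm _ _

/-- the LEFTWARD windows of the top shell `[θ(1−ρ), θ)` (width `δ ≤ θ`, `θ(1−ρ) ≥ 0`) lie in the letter, so the
tilted potential rises by at most `(aθ + |h|)(x − y)` along them. [bookkeeping] -/
theorem tiltedPotential_slope_topShell {a h θ ρ δ : ℝ} (ha : 0 ≤ a) (hθ : 0 < θ) (hθρ : 0 ≤ θ * (1 - ρ))
    (hδθ : δ ≤ θ) :
    ∀ x ∈ Ico (θ * (1 - ρ)) θ, ∀ y ∈ Icc (x - δ) x,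
      (a / 2 * y ^ 2 + h * y) - (a / 2 * x ^ 2 + h * x) ≤ (a * θ + |h|) * (x - y) := by
  intro x hx y hy
  have hx' : x ∈ Icc (-θ) θ := ⟨by linarith [hx.1], hx.2.le⟩
  have hy' : y ∈ Icc (-θ) θ := ⟨by linarith [hy.1, hx.1], by linarith [hy.2, hx.2]⟩
  have h1 := tiltedPotential_sub_le (h := h) ha hx' hy'
  rwa [abs_of_nonpos (by linarith [hy.2] : y - x ≤ 0), neg_sub] at h1

/-- the RIGHTWARD windows of the bottom shell `(−θ, −θ(1−ρ)]` likewise. [bookkeeping] -/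
theorem tiltedPotential_slope_bottomShell {a h θ ρ δ : ℝ} (ha : 0 ≤ a) (hθ : 0 < θ) (hθρ : 0 ≤ θ * (1 - ρ))
    (hδθ : δ ≤ θ) :
    ∀ x ∈ Ioc (-θ) (-(θ * (1 - ρ))), ∀ y ∈ Icc x (x + δ),
      (a / 2 * y ^ 2 + h * y) - (a / 2 * x ^ 2 + h * x) ≤ (a * θ + |h|) * (y - x) := by
  intro x hx y hy
  have hx' : x ∈ Icc (-θ) θ := ⟨hx.1.le, by linarith [hx.2]⟩
  have hy' : y ∈ Icc (-θ) θ := ⟨by linarith [hy.1, hx.1], by linarith [hy.2, hx.2]⟩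
  have h1 := tiltedPotential_sub_le (h := h) ha hx' hy'
  rwa [abs_of_nonneg (by linarith [hy.1] : 0 ≤ y - x)] at h1

end Slope

/-! ## §3  The tilted Gaussian letter: (M1) with a constant LINEAR in the tilt work -/

section TiltedLetter

/-- the window bookkeeping: with `Λ ≥ 0`, `m = max(θΛ, 1)`, `δ = θ∕m` one has `0 < δ ≤ θ`, `Λδ ≤ 1` and
`e^{Λδ}·θ∕δ ≤ e·m`. [bookkeeping] -/
theorem window_bookkeeping {θ : ℝ} (Λ : ℝ) (hθ : 0 < θ) :
    0 < θ / max (θ * Λ) 1 ∧ θ / max (θ * Λ) 1 ≤ θ ∧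
      Real.exp (Λ * (θ / max (θ * Λ) 1)) * θ / (θ / max (θ * Λ) 1) ≤ Real.exp 1 * max (θ * Λ) 1 := by
  set m : ℝ := max (θ * Λ) 1
  have hm1 : 1 ≤ m := le_max_right _ _
  have hm0 : 0 < m := by linarith
  have hΛδ : Λ * (θ / m) ≤ 1 := by
    rw [mul_div_assoc', div_le_one hm0, mul_comm]
    exact le_max_left _ _
  refine ⟨div_pos hθ hm0, div_le_self hθ.le hm1, ?_⟩
  have hθδ : Real.exp (Λ * (θ / m)) * θ / (θ / m) = Real.exp (Λ * (θ / m)) * m := by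
    rw [div_div_eq_mul_div, mul_assoc, mul_div_assoc, mul_div_cancel_left₀ m hθ.ne']
  rw [hθδ]
  exact mul_le_mul_of_nonneg_right (Real.exp_le_exp.2 hΛδ) hm0.le

/-- ★ **THE TILTED LETTER SATISFIES (M1) WITH A LINEAR CONSTANT.**  The fibre density `e^{−(½at² + ht)}` (`a ≥ 0`,
any tilt `h`) on the letter `[−θ, θ]` under Lebesgue measure (the law of 38o §2 ★ `slotAntiConcentration_tiltedLetter`),
statistic `u t = t`, `0 < ρ ≤ 1`, satisfies `SlotAntiConcentration` with `D = e·max(θ(aθ + |h|), 1)` — LINEAR in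
the tilt work `θ|h|` and the Gaussian depth `aθ² = x_b²` (lens g31 N211: `D ≲ e(x_b² + θ_bΛ_b)`), against 38o's
`½e^{aθ² + 4θ|h|}`: §1 ★ with `δ = θ∕max(θΛ, 1)`, `Λ = aθ + |h|`, `M = e^{Λδ} ≤ e` (§2). [textbook] -/
theorem slotAntiConcentration_tiltedLetter_linear {a h θ ρ : ℝ} (ha : 0 ≤ a) (hθ : 0 < θ) (hρ : 0 < ρ)
    (hρ1 : ρ ≤ 1) :
    SlotAntiConcentration
      (((volume : Measure ℝ).restrict (Icc (-θ) θ)).withDensity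
        fun t => ENNReal.ofReal (Real.exp (-(a / 2 * t ^ 2 + h * t)))) (fun t => t) θ ρ
      (Real.exp 1 * max (θ * (a * θ + |h|)) 1) := by
  have hΛ : 0 ≤ a * θ + |h| := by positivity
  obtain ⟨hδ, hδθ, hbound⟩ := window_bookkeeping (a * θ + |h|) hθ
  have hWm : Measurable fun t : ℝ => a / 2 * t ^ 2 + h * t := by fun_prop
  have hg : Measurable fun t : ℝ => ENNReal.ofReal (Real.exp (-(a / 2 * t ^ 2 + h * t))) :=
    ENNReal.measurable_ofReal.comp (Real.measurable_exp.comp hWm.neg)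
  have hθρ : 0 ≤ θ * (1 - ρ) := mul_nonneg hθ.le (by linarith)
  exact slotAntiConcentration_mono hρ.le hbound
    (slotAntiConcentration_letter_of_nonCollapse_left hg hθ hρ1 hδ hδθ (Real.exp_pos _).le
      (nonCollapse_left_of_slope (W := fun t : ℝ => a / 2 * t ^ 2 + h * t) hΛ
        (tiltedPotential_slope_topShell ha hθ hθρ hδθ)))

/-- ★ **THE TILTED TWO-SIDED LETTER SATISFIES (M1) WITH A LINEAR CONSTANT** — statistic `u t = |t|` (the collar road's
kept letters), `D = 2e·max(θ(aθ + |h|), 1)`: §1's two-sided device with the leftward slope on the top shell (§2) and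
the rightward slope on the bottom shell (n21-d part 8 `nonCollapse_of_logLipschitz` BY NAME). [textbook] -/
theorem slotAntiConcentration_tiltedLetter_linear_abs {a h θ ρ : ℝ} (ha : 0 ≤ a) (hθ : 0 < θ) (hρ : 0 < ρ)
    (hρ1 : ρ ≤ 1) :
    SlotAntiConcentration
      (((volume : Measure ℝ).restrict (Icc (-θ) θ)).withDensity
        fun t => ENNReal.ofReal (Real.exp (-(a / 2 * t ^ 2 + h * t)))) (fun t => |t|) θ ρ
      (2 * (Real.exp 1 * max (θ * (a * θ + |h|)) 1)) := by
  have hΛ : 0 ≤ a * θ + |h| := by positivity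
  obtain ⟨hδ, hδθ, hbound⟩ := window_bookkeeping (a * θ + |h|) hθ
  have hWm : Measurable fun t : ℝ => a / 2 * t ^ 2 + h * t := by fun_prop
  have hg : Measurable fun t : ℝ => ENNReal.ofReal (Real.exp (-(a / 2 * t ^ 2 + h * t))) :=
    ENNReal.measurable_ofReal.comp (Real.measurable_exp.comp hWm.neg)
  have hθρ : 0 ≤ θ * (1 - ρ) := mul_nonneg hθ.le (by linarith)
  exact slotAntiConcentration_mono hρ.le (mul_le_mul_of_nonneg_left hbound (by norm_num))
    (slotAntiConcentration_letter_abs_of_nonCollapse hg hθ hρ1 hδ hδθ (Real.exp_pos _).le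
      (nonCollapse_left_of_slope (W := fun t : ℝ => a / 2 * t ^ 2 + h * t) hΛ
        (tiltedPotential_slope_topShell ha hθ hθρ hδθ))
      (nonCollapse_of_logLipschitz (W := fun t : ℝ => a / 2 * t ^ 2 + h * t) hΛ
        (tiltedPotential_slope_bottomShell ha hθ hθρ hδθ)))

end TiltedLetter

/-! ## §4  The `min` junction: the (M1) constant of the tilted letter is `min(ratio transfer, linear)` -/

section MinJunction

/-- two (M1) constants for the same slot ⇒ their `min`. [bookkeeping] -/
theorem slotAntiConcentration_min {Ω : Type*} [MeasurableSpace Ω] {μ : Measure Ω} {u : Ω → ℝ} {θ ρ D₁ D₂ : ℝ}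
    (h₁ : SlotAntiConcentration μ u θ ρ D₁) (h₂ : SlotAntiConcentration μ u θ ρ D₂) :
    SlotAntiConcentration μ u θ ρ (min D₁ D₂) := by
  rcases min_choice D₁ D₂ with h | h <;> rw [h]
  · exact h₁
  · exact h₂

/-- **THE ONE-SIDED TILTED LETTER: `D = min(½e^{2·osc}, e·max(θ(aθ+|h|),1))`** — lens g31's pen note (1)(b)
«(M1) constant ≤ min(½e^{2·osc}, linear)» as one kernel sentence (38o ★ `slotAntiConcentration_tiltedLetter` ∧ §3 ★).
The exponential member wins for small oscillation (`osc → 0`: `½` against `e`), the linear one for large tilt work.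
[textbook] -/
theorem slotAntiConcentration_tiltedLetter_min {a h θ ρ : ℝ} (ha : 0 ≤ a) (hθ : 0 < θ) (hρ : 0 < ρ)
    (hρ1 : ρ ≤ 1) :
    SlotAntiConcentration
      (((volume : Measure ℝ).restrict (Icc (-θ) θ)).withDensity
        fun t => ENNReal.ofReal (Real.exp (-(a / 2 * t ^ 2 + h * t)))) (fun t => t) θ ρ
      (min (Real.exp (a / 2 * θ ^ 2 + 2 * θ * |h|) / Real.exp (-(a / 2 * θ ^ 2 + 2 * θ * |h|)) * (1 / 2))
        (Real.exp 1 * max (θ * (a * θ + |h|)) 1)) :=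
  slotAntiConcentration_min (slotAntiConcentration_tiltedLetter ha hθ hρ hρ1)
    (slotAntiConcentration_tiltedLetter_linear ha hθ hρ hρ1)

/-- **THE TWO-SIDED TILTED LETTER: `D = min(e^{2·osc}, 2e·max(θ(aθ+|h|),1))`** (38o ★ `…_abs` ∧ §3 ★ `…_abs`).
[textbook] -/
theorem slotAntiConcentration_tiltedLetter_abs_min {a h θ ρ : ℝ} (ha : 0 ≤ a) (hθ : 0 < θ) (hρ : 0 < ρ)
    (hρ1 : ρ ≤ 1) :
    SlotAntiConcentration
      (((volume : Measure ℝ).restrict (Icc (-θ) θ)).withDensity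
        fun t => ENNReal.ofReal (Real.exp (-(a / 2 * t ^ 2 + h * t)))) (fun t => |t|) θ ρ
      (min (Real.exp (a / 2 * θ ^ 2 + 2 * θ * |h|) / Real.exp (-(a / 2 * θ ^ 2 + 2 * θ * |h|)) * 1)
        (2 * (Real.exp 1 * max (θ * (a * θ + |h|)) 1))) :=
  slotAntiConcentration_min (slotAntiConcentration_tiltedLetter_abs ha hθ hρ)
    (slotAntiConcentration_tiltedLetter_linear_abs ha hθ hρ hρ1)

end MinJunction

end Summit.QuantumFields.YangMills.Theorems.N21TiltedFibreProfileLinear
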